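import Summits.QuantumFields.BalabanUV.Beta.D1BFx.ChartDefectRowLamfClosed
import Summits.QuantumFields.BalabanUV.Beta.FP.ConstrainedGhostIRCoarse
import Summits.QuantumFields.BalabanUV.Beta.D1BFx.RoadPinKernelBdd

/-!
# `BalabanUV.Beta.D1BFx.ChartDefectRowLamfScales` — road «BF-x», binder row D1, PART 24-hyb HEAD ON THE SCALES (`ChartDefectHeadScales`' rows): **ROW (lamf) WITH ONE
# m-INDEPENDENT CONSTANT** (leaf-03 g34, TT33; the scales form of TT31 `ChartDefectRowLamfMass` + TT32 `ChartDefectRowLamfClosed`).  At every scale `n = Lc^m` (`Lc` odd) the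
# (lamf) row kernel `Wlamf m a e z := ½·tadpole G₀ (W^{Λ}_f a 0 e z)` (the pin `hWlamf` of `ChartDefectHeadScales.abs_secondMoment_chartDefect_scales_le_of_rows`, VERBATIM up to
# bound-variable names) has absolutely summable (1.22) second moments and `|secondMoment (Wlamf m) μ ν| ≤ C_lamf*` with `C_lamf*` FIXED BEFORE `∀ m` — modulo ONLY the STRAIGHT kernel's sup
# letter `∀ m, Bdd (KInvStep 3 (Lc^m) 0) S₀` (one `S₀` for all scales, displayed; the road's dressed leg then costs `(1+16·Lc^m)²`, g63 «G0-BDD», absorbed by the Λ-pack's `n⁻³`) and a bound `∀ m, |cΛ m| ≤ cΛ*` on the literal's Λ-scalars (the Λ-lock `cΛ m·(Lc^m)⁴ = 2` gives `cΛ* = 2`):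
# `C_lamf* = ((cΛ*∕2)·(S₀·(2·GΛ*·MV* + 2·GΛ*·MV*)))·Σ'_x |x|₁²e^{−(κ′∕16)|x|₁}`, `MV* = C_pack·(289·mT*)`.
HOW.  Per scale the row is TT32 `decay510_row_lamf_record_of_env` at the n-FREE rate `σ_m := κ′∕(16·Lc^m)` (`(Lc^m)·σ_m = κ′∕16`) with the generator envelope chosen by blocking:
`Lc^m ≥ 3` — TT31's SPLIT envelope `GΛ(Lc^m)`; `Lc^m = 1` (the only odd blocking below `3`) — TT31's one-envelope letter `GΛ₁(1)`; §1 proves the m-INDEPENDENT MAJORANTS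
`GΛ(n) ≤ GΛ* := (8·C_int′ + 16·C_G′)·e^{2κ′}` (`Ci·Bi = 8·C_int′` and `Cf·Bf = 16·C_G′` EXACTLY — `|box 4 n| = n⁴` —, `r_G·(|ρ_c|₁ + 4n) ≤ 2κ′` by `|ρ_c|₁ ≤ 4n`), `GΛ₁(n) ≤ n·GΛ*`,
`(1+16n)²·mT_Λ(n) ≤ 289·mT*`, `mT* := KΛ′·(200·e^{κ′})·e^{κ′∕2}` (`ell 4 n = 10n`, `(1+16n)²·(n⁵)⁻¹·n² ≤ 289`), then lit `decay510_mono_const`, `absMoment₂_of_decay510`, `secondMoment_abs_le_of_decay510`.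
[folklore] real-inequality bookkeeping BY NAME over TT31∕TT32; no definition, no `def … : Prop`, nothing cited, 0 sorry.  LOCATED (zero weight): the bound is far from sharp
(`C_lamf(n) ≍ |cΛ m|·S·n⁻³` is replaced by its value at `n = 1`); sharpness is not the Scales binder's question — m-independence is.

HONEST DEPENDENCY (cell records, verbatim): «continuum YM on T⁴ ⇐ BetaPertH ∧ nine spine estimates (0/9 proved); BetaPertH ⇐ (D1) ∧ (D4) ∧
CAP+tail; G-an2-4 gates asym, D1 and NE2/3/4.»  HONEST FRAMING (cell contract, verbatim): «discharging `BetaPertH` makes Bałaban's UV stability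
UNCONDITIONAL — a real constructive-QFT result; it is NOT the continuum limit and NOT the Clay problem.»  ONE displayed row of the HEAD-on-the-scales priced MODULO the displayed
m-uniform sup letter `S₀` of the straight one-shot kernel and the Λ-scalar bound `cΛ*` (their provenance — g62 «G0-DECAY»'s `S₀ = CΓ + …` modulo `hΓ ∕ hΦ`, the Λ-lock — NOT discharged here) — per-word INTERMEDIATE
(an2 R-D1-g45-4 (3)), not the HEAD, not the END.  0∕4 row-D1 binders (hW ∕ hR ∕ D1Tel ∕ D1Rep); (J1) ONE OPEN ROW (eight displayed rows); (K) NOT closed; NOT D1,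
NEVER «G-an2-4 closed», NOT `BetaPertH`, NOT continuum, NOT Clay.

ABSOLUTE RULE (cell charter, verbatim): «No internally-minted statement may enter as a cited fact. Every hypothesis is either kernel-proved in
this package or a verbatim quotation of a PUBLISHED theorem with page reference. The manuscript(s) under audit are NOT citable for their own
disputed steps — they are the thing under adjudication; programme-internal (2001/route/tribunal) claims are never citable.»

Unit `b2b-balaban-beta-d1-formalise-leaf-03` (gen 34), D1 formalisation swarm LEAF PROVER 03, road «BF-x»; 2026-08-24.  No existing file touched.
-/

noncomputable section

namespace Summit.QuantumFields.BalabanUV.Beta.D1BFx.ChartDefectRowLamfScales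

open Finset
open scoped BigOperators
open Literature.MathematicalPhysics.QuantumFieldTheory
open Literature.MathematicalPhysics.QuantumFieldTheory.Balaban1983to89
open Literature.MathematicalPhysics.QuantumFieldTheory.Balaban1983to89.Beta
open B12Sec2to5 (l1 l1_nonneg Decay510 secondMoment_abs_le_of_decay510)
open DecimatedMomentSummable (AbsMoment₂ absMoment₂_of_decay510)
open B5Hk163Strip (kappa163 kappa163_pos)
open B5Hk163Decay (MG163)
open B5Hk163TorusHolderDecay (MD163)
open B4TorusKernel (periodConst)
open ExpKernelCalculus (Site MKer Zl Zl_nonneg comp tadpole decay510_mono_const)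
open AveragingHessianKernels (ell)
open AffineAveraging (box toSite)
open AveragingContours (blk)
open AveragingContoursRooted (ctr ctrOff ctrOff_mem_box)
open KernelWard (Bdd)
open OneStepResolventKernel (Fib KInv)
open OneStepKernelFamily (colH KInvStep vertexOfK)
open InterLevelTransport (SLam)
open StepJetData (wilsonA)
open BalabanStepJets (lamCoeffOf)
open Summit.QuantumFields.BalabanUV.Beta.BorderedHessian (diagK)
open Summit.QuantumFields.BalabanUV.Beta.AxialDressingRooted (coDressKBmAt)
open Summit.QuantumFields.BalabanUV.Beta.AveragingWardRootedStencils (legSite)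
open Summit.QuantumFields.BalabanUV.Beta.CompositeCorrectorLocality (blockSitesF)
open Summit.QuantumFields.BalabanUV.Beta.SymAveragingHessianCounts (symVhSAt symHessFFAt)
open Summit.QuantumFields.BalabanUV.Beta.SymSecondOrderTablesAn1 (symTablesAn1S2)
open Summit.QuantumFields.BalabanUV.Beta.CombChartStepJets (JsB12CombSh0)
open Summit.QuantumFields.BalabanUV.Beta.SymCorrectorFace (faceWt)
open Summit.QuantumFields.BalabanUV.Beta.FP.ConstrainedGhostIRCoarse (card_box_four)
open Summit.QuantumFields.BalabanUV.Beta.D1BFx.RoadPinKernelBdd (bdd_G₀_of_bdd)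
open Summit.QuantumFields.BalabanUV.Beta.D1BFx.PackedColumnEnvelopeSplit (pin_interior_weight_nonneg pin_face_weight_nonneg)
open Summit.QuantumFields.BalabanUV.Beta.D1BFx.ChartDefectRowLamfMass (abs_faceLamGen_G₀_legSite_le abs_faceLamGen_G₀_legSite_le_one l1_ctr_le exp_rG_le cInt_nonneg cG_nonneg)
open Summit.QuantumFields.BalabanUV.Beta.D1BFx.ChartDefectRowLamfClosed (decay510_row_lamf_record_of_env packMassConst_nonneg)

variable {d : ℕ}

/-! ## §1 The m-independent majorants of the closed constants (`n ≥ 1`) -/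

section Majorants

variable (n : ℕ) [NeZero n]

/-- [folklore] **THE INTERIOR PRODUCT IS EXACTLY `8·C_int′`**: `Ci·Bi = ((n⁵)⁻¹·C_int′)·((n⁴∕2)·(4·(n·4))) = 8·C_int′`. -/
theorem ci_mul_bi_eq :
    ((((n : ℕ) : ℝ) ^ 5)⁻¹ * (8 * (MD163 4 * periodConst (kappa163 4) 3) * Real.exp (kappa163 4 / 4))) * ((n : ℝ) ^ 4 / 2 * ((((3 : ℕ) : ℝ) + 1) * ((n : ℝ) * (((3 : ℕ) : ℝ) + 1)))) = 8 * (8 * (MD163 4 * periodConst (kappa163 4) 3) * Real.exp (kappa163 4 / 4)) := by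
  have hn0 : (n : ℝ) ≠ 0 := by exact_mod_cast (NeZero.ne n)
  push_cast
  field_simp
  ring

/-- [folklore] **THE FACE PRODUCT IS EXACTLY `16·C_G′`**: `Cf·Bf = ((n⁴)⁻¹·C_G′)·((n⁴∕2)·(|box|⁻¹·(2·4²·n⁴))) = 16·C_G′` (`|box 4 n| = n⁴` — the FP road's `ConstrainedGhostIRCoarse.card_box_four` BY NAME). -/
theorem cf_mul_bf_eq :
    ((((n : ℕ) : ℝ) ^ 4)⁻¹ * ((MG163 4 * periodConst (kappa163 4) 3) * (1 + 8 * (1 + Real.exp (kappa163 4 / 4))) * Real.exp (kappa163 4 / 4))) * ((n : ℝ) ^ 4 / 2 * ((((box (3 + 1) n).card : ℝ))⁻¹ * (2 * ((((3 : ℕ) : ℝ)) + 1) ^ 2 * (n : ℝ) ^ (3 + 1)))) = 16 * ((MG163 4 * periodConst (kappa163 4) 3) * (1 + 8 * (1 + Real.exp (kappa163 4 / 4))) * Real.exp (kappa163 4 / 4)) := by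
  have hn0 : (n : ℝ) ≠ 0 := by exact_mod_cast (NeZero.ne n)
  rw [card_box_four (N := n)]
  push_cast
  field_simp
  ring

/-- [folklore] The majorant `GΛ*` is non-negative. -/
theorem faceLamGenStar_nonneg : 0 ≤ ((8 * (8 * (MD163 4 * periodConst (kappa163 4) 3) * Real.exp (kappa163 4 / 4)) + 16 * ((MG163 4 * periodConst (kappa163 4) 3) * (1 + 8 * (1 + Real.exp (kappa163 4 / 4))) * Real.exp (kappa163 4 / 4))) * Real.exp (2 * (kappa163 4 / 4))) := by
  have hC1 := cInt_nonneg
  have hC2 := cG_nonneg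
  positivity

/-- [folklore] **THE SPLIT ENVELOPE's m-INDEPENDENT MAJORANT**: `GΛ(n) ≤ GΛ* := (8·C_int′ + 16·C_G′)·e^{2κ′}` for every `n ≥ 1`. -/
theorem faceLamGenConst_le (hn : 1 ≤ n) :
    ((((((n : ℕ) : ℝ) ^ 5)⁻¹ * (8 * (MD163 4 * periodConst (kappa163 4) 3) * Real.exp (kappa163 4 / 4))) * ((n : ℝ) ^ 4 / 2 * ((((3 : ℕ) : ℝ) + 1) * ((n : ℝ) * (((3 : ℕ) : ℝ) + 1)))) + ((((n : ℕ) : ℝ) ^ 4)⁻¹ * ((MG163 4 * periodConst (kappa163 4) 3) * (1 + 8 * (1 + Real.exp (kappa163 4 / 4))) * Real.exp (kappa163 4 / 4))) * ((n : ℝ) ^ 4 / 2 * ((((box (3 + 1) n).card : ℝ))⁻¹ * (2 * ((((3 : ℕ) : ℝ)) + 1) ^ 2 * (n : ℝ) ^ (3 + 1))))) * Real.exp ((kappa163 4 / 4 / (4 * ((n : ℕ) : ℝ))) * (l1 (ctr 4 n) + ((3 + 1 : ℕ) : ℝ) * (n : ℝ)))) ≤ ((8 * (8 * (MD163 4 *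 periodConst (kappa163 4) 3) * Real.exp (kappa163 4 / 4)) + 16 * ((MG163 4 * periodConst (kappa163 4) 3) * (1 + 8 * (1 + Real.exp (kappa163 4 / 4))) * Real.exp (kappa163 4 / 4))) * Real.exp (2 * (kappa163 4 / 4))) := by
  rw [ci_mul_bi_eq n, cf_mul_bf_eq n]
  have hC1 := cInt_nonneg
  have hC2 := cG_nonneg
  exact mul_le_mul_of_nonneg_left (exp_rG_le n hn) (by positivity)

/-- [folklore] **THE ONE-ENVELOPE CONSTANT's MAJORANT**: `GΛ₁(n) ≤ n·GΛ*` (`Cf·Bi = 8·C_G′·n` exactly; `8·C_G′ ≤ 8·C_int′ + 16·C_G′`). Used at `n = 1` only. -/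
theorem faceLamGenConstOne_le (hn : 1 ≤ n) :
    ((((((n : ℕ) : ℝ) ^ 4)⁻¹ * ((MG163 4 * periodConst (kappa163 4) 3) * (1 + 8 * (1 + Real.exp (kappa163 4 / 4))) * Real.exp (kappa163 4 / 4))) * ((n : ℝ) ^ 4 / 2 * ((((3 : ℕ) : ℝ) + 1) * ((n : ℝ) * (((3 : ℕ) : ℝ) + 1))))) * Real.exp ((kappa163 4 / 4 / (4 * ((n : ℕ) : ℝ))) * (l1 (ctr 4 n) + ((3 + 1 : ℕ) : ℝ) * (n : ℝ)))) ≤ (n : ℝ) * ((8 * (8 * (MD163 4 * periodConst (kappa163 4) 3) * Real.exp (kappa163 4 / 4)) + 16 * ((MG163 4 * periodConst (kappa163 4) 3) * (1 + 8 * (1 + Real.exp (kappa163 4 / 4))) * Real.exp (kappa163 4 / 4))) * Real.exp (2 * (kappa163 4 / 4))) := by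
  have hn0 : (n : ℝ) ≠ 0 := by exact_mod_cast (NeZero.ne n)
  have hnpos : (0 : ℝ) < n := by exact_mod_cast hn
  have hC1 := cInt_nonneg
  have hC2 := cG_nonneg
  have e1 : ((((n : ℕ) : ℝ) ^ 4)⁻¹ * ((MG163 4 * periodConst (kappa163 4) 3) * (1 + 8 * (1 + Real.exp (kappa163 4 / 4))) * Real.exp (kappa163 4 / 4))) * ((n : ℝ) ^ 4 / 2 * ((((3 : ℕ) : ℝ) + 1) * ((n : ℝ) * (((3 : ℕ) : ℝ) + 1)))) = (n : ℝ) * (8 * ((MG163 4 * periodConst (kappa163 4) 3) * (1 + 8 * (1 + Real.exp (kappa163 4 / 4))) * Real.exp (kappa163 4 / 4))) := by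
    push_cast
    field_simp
    ring
  rw [e1, mul_assoc]
  refine mul_le_mul_of_nonneg_left ?_ hnpos.le
  calc 8 * ((MG163 4 * periodConst (kappa163 4) 3) * (1 + 8 * (1 + Real.exp (kappa163 4 / 4))) * Real.exp (kappa163 4 / 4)) * Real.exp ((kappa163 4 / 4 / (4 * ((n : ℕ) : ℝ))) * (l1 (ctr 4 n) + ((3 + 1 : ℕ) : ℝ) * (n : ℝ)))
      ≤ 8 * ((MG163 4 * periodConst (kappa163 4) 3) * (1 + 8 * (1 + Real.exp (kappa163 4 / 4))) * Real.exp (kappa163 4 / 4)) * Real.exp (2 * (kappa163 4 / 4)) := mul_le_mul_of_nonneg_left (exp_rG_le n hn) (by positivity)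
    _ ≤ ((8 * (8 * (MD163 4 * periodConst (kappa163 4) 3) * Real.exp (kappa163 4 / 4)) + 16 * ((MG163 4 * periodConst (kappa163 4) 3) * (1 + 8 * (1 + Real.exp (kappa163 4 / 4))) * Real.exp (kappa163 4 / 4))) * Real.exp (2 * (kappa163 4 / 4))) := by
        refine mul_le_mul_of_nonneg_right ?_ (Real.exp_pos _).le
        nlinarith

/-- [folklore] **THE Λ-PACK MASS TIMES THE DRESSING FACTOR, m-INDEPENDENT MAJORANT** at the rate `σ := κ′∕(16n)`: `(1 + 4·(4·n))²·mT_Λ(n) ≤ 289·mT*`,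
`mT* := KΛ′·(200·e^{κ′})·e^{κ′∕2}` (`ell 4 n = 10n`, `e^{σ·16n} = e^{κ′}`, `(1+16n)²·(n⁵)⁻¹·(10n)² ≤ 289·100` for `n ≥ 1`) — the `(1+16n)²` is g63 «G0-BDD»'s dressing cost
`Bdd K₀ S₀ ⟹ Bdd G₀ ((1+4(4n))²·S₀)`, absorbed here by the Λ-pack's `n⁻³`. -/
theorem packMassConst_dressed_le (hn : 1 ≤ n) :
    (1 + 4 * (((3 : ℝ) + 1) * n)) ^ 2 * ((((n : ℝ) ^ 5)⁻¹ * (4 * ((3 : ℝ) ^ (3 + 1) * ((3 + 1 : ℕ) : ℝ) * (16 * ((3 + 1 : ℕ) : ℝ)) * (MG163 4 * periodConst (kappa163 4) 3)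
              * Real.exp (kappa163 4 / 4) * Real.exp (kappa163 4 / 4) * Real.exp (kappa163 4 / 4))
            * Real.exp (kappa163 4 / 4 / 2) * Zl 4 (kappa163 4 / 4 / 8)) * (2 * (ell (3 + 1) n : ℝ) ^ 2 * Real.exp ((kappa163 4 / 4 / (16 * ((n : ℕ) : ℝ))) * (4 * ((((3 : ℕ) : ℝ) + 1) * (n : ℝ)))))) * Real.exp (kappa163 4 / 4 / 2))
      ≤ 289 * (((4 * ((3 : ℝ) ^ (3 + 1) * ((3 + 1 : ℕ) : ℝ) * (16 * ((3 + 1 : ℕ) : ℝ)) * (MG163 4 * periodConst (kappa163 4) 3)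
              * Real.exp (kappa163 4 / 4) * Real.exp (kappa163 4 / 4) * Real.exp (kappa163 4 / 4))
            * Real.exp (kappa163 4 / 4 / 2) * Zl 4 (kappa163 4 / 4 / 8)) * (2 * 100 * Real.exp (kappa163 4 / 4))) * Real.exp (kappa163 4 / 4 / 2)) := by
  have hn0 : (n : ℝ) ≠ 0 := by exact_mod_cast (NeZero.ne n)
  have hnpos : (0 : ℝ) < n := by exact_mod_cast hn
  have hn1 : (1 : ℝ) ≤ n := by exact_mod_cast hn
  have hκ : 0 < kappa163 4 := kappa163_pos 4
  have hell : ((ell (3 + 1) n : ℕ) : ℝ) = 10 * (n : ℝ) := by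
    simp only [AveragingHessianKernels.ell]; push_cast; ring
  have hexp : Real.exp ((kappa163 4 / 4 / (16 * ((n : ℕ) : ℝ))) * (4 * ((((3 : ℕ) : ℝ) + 1) * (n : ℝ)))) = Real.exp (kappa163 4 / 4) := by
    congr 1; push_cast; field_simp; ring
  rw [hell, hexp]
  have hK : 0 ≤ (4 * ((3 : ℝ) ^ (3 + 1) * ((3 + 1 : ℕ) : ℝ) * (16 * ((3 + 1 : ℕ) : ℝ)) * (MG163 4 * periodConst (kappa163 4) 3)
              * Real.exp (kappa163 4 / 4) * Real.exp (kappa163 4 / 4) * Real.exp (kappa163 4 / 4))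
            * Real.exp (kappa163 4 / 4 / 2) * Zl 4 (kappa163 4 / 4 / 8)) := by
    have hM : 0 ≤ MG163 4 * periodConst (kappa163 4) 3 := by
      have h' := cG_nonneg
      have hpos : (0 : ℝ) < (1 + 8 * (1 + Real.exp (kappa163 4 / 4))) * Real.exp (kappa163 4 / 4) := by positivity
      have : 0 ≤ MG163 4 * periodConst (kappa163 4) 3 * ((1 + 8 * (1 + Real.exp (kappa163 4 / 4))) * Real.exp (kappa163 4 / 4)) := by
        rw [← mul_assoc]; exact h'
      exact (mul_nonneg_iff_of_pos_right hpos).1 this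
    have hZ : 0 ≤ Zl 4 (kappa163 4 / 4 / 8) := Zl_nonneg (by positivity)
    positivity
  -- the `n`-dependence: `(1 + 16n)²·(n⁵)⁻¹·(10n)² ≤ 289·100`
  have h17 : 1 + 4 * (((3 : ℝ) + 1) * n) ≤ 17 * (n : ℝ) := by linarith
  have h17' : (1 + 4 * (((3 : ℝ) + 1) * n)) ^ 2 ≤ (17 * (n : ℝ)) ^ 2 := pow_le_pow_left₀ (by positivity) h17 2
  have hpow : (1 + 4 * (((3 : ℝ) + 1) * n)) ^ 2 * (((n : ℝ) ^ 5)⁻¹ * (10 * (n : ℝ)) ^ 2) ≤ 289 * 100 := by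
    have e : ((n : ℝ) ^ 5)⁻¹ * (10 * (n : ℝ)) ^ 2 = 100 / (n : ℝ) ^ 3 := by field_simp; ring
    rw [e]
    calc (1 + 4 * (((3 : ℝ) + 1) * n)) ^ 2 * (100 / (n : ℝ) ^ 3)
        ≤ (17 * (n : ℝ)) ^ 2 * (100 / (n : ℝ) ^ 3) := mul_le_mul_of_nonneg_right h17' (by positivity)
      _ = 289 * 100 / (n : ℝ) := by field_simp; ring
      _ ≤ 289 * 100 := div_le_self (by norm_num) hn1
  have key : (1 + 4 * (((3 : ℝ) + 1) * n)) ^ 2 * (((n : ℝ) ^ 5)⁻¹ * (4 * ((3 : ℝ) ^ (3 + 1) * ((3 + 1 : ℕ) : ℝ) * (16 * ((3 + 1 : ℕ) : ℝ)) * (MG163 4 * periodConst (kappa163 4) 3)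
              * Real.exp (kappa163 4 / 4) * Real.exp (kappa163 4 / 4) * Real.exp (kappa163 4 / 4))
            * Real.exp (kappa163 4 / 4 / 2) * Zl 4 (kappa163 4 / 4 / 8)) * (2 * (10 * (n : ℝ)) ^ 2 * Real.exp (kappa163 4 / 4)))
      ≤ 289 * ((4 * ((3 : ℝ) ^ (3 + 1) * ((3 + 1 : ℕ) : ℝ) * (16 * ((3 + 1 : ℕ) : ℝ)) * (MG163 4 * periodConst (kappa163 4) 3)
              * Real.exp (kappa163 4 / 4) * Real.exp (kappa163 4 / 4) * Real.exp (kappa163 4 / 4))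
            * Real.exp (kappa163 4 / 4 / 2) * Zl 4 (kappa163 4 / 4 / 8)) * (2 * 100 * Real.exp (kappa163 4 / 4))) := by
    have e : (1 + 4 * (((3 : ℝ) + 1) * n)) ^ 2 * (((n : ℝ) ^ 5)⁻¹ * (4 * ((3 : ℝ) ^ (3 + 1) * ((3 + 1 : ℕ) : ℝ) * (16 * ((3 + 1 : ℕ) : ℝ)) * (MG163 4 * periodConst (kappa163 4) 3)
              * Real.exp (kappa163 4 / 4) * Real.exp (kappa163 4 / 4) * Real.exp (kappa163 4 / 4))
            * Real.exp (kappa163 4 / 4 / 2) * Zl 4 (kappa163 4 / 4 / 8)) * (2 * (10 * (n : ℝ)) ^ 2 * Real.exp (kappa163 4 / 4)))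
        = (4 * ((3 : ℝ) ^ (3 + 1) * ((3 + 1 : ℕ) : ℝ) * (16 * ((3 + 1 : ℕ) : ℝ)) * (MG163 4 * periodConst (kappa163 4) 3)
              * Real.exp (kappa163 4 / 4) * Real.exp (kappa163 4 / 4) * Real.exp (kappa163 4 / 4))
            * Real.exp (kappa163 4 / 4 / 2) * Zl 4 (kappa163 4 / 4 / 8)) * (2 * ((1 + 4 * (((3 : ℝ) + 1) * n)) ^ 2 * (((n : ℝ) ^ 5)⁻¹ * (10 * (n : ℝ)) ^ 2)) * Real.exp (kappa163 4 / 4)) := by ring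
    have e' : 289 * ((4 * ((3 : ℝ) ^ (3 + 1) * ((3 + 1 : ℕ) : ℝ) * (16 * ((3 + 1 : ℕ) : ℝ)) * (MG163 4 * periodConst (kappa163 4) 3)
              * Real.exp (kappa163 4 / 4) * Real.exp (kappa163 4 / 4) * Real.exp (kappa163 4 / 4))
            * Real.exp (kappa163 4 / 4 / 2) * Zl 4 (kappa163 4 / 4 / 8)) * (2 * 100 * Real.exp (kappa163 4 / 4)))
        = (4 * ((3 : ℝ) ^ (3 + 1) * ((3 + 1 : ℕ) : ℝ) * (16 * ((3 + 1 : ℕ) : ℝ)) * (MG163 4 * periodConst (kappa163 4) 3)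
              * Real.exp (kappa163 4 / 4) * Real.exp (kappa163 4 / 4) * Real.exp (kappa163 4 / 4))
            * Real.exp (kappa163 4 / 4 / 2) * Zl 4 (kappa163 4 / 4 / 8)) * (2 * (289 * 100) * Real.exp (kappa163 4 / 4)) := by ring
    rw [e, e']
    refine mul_le_mul_of_nonneg_left ?_ hK
    refine mul_le_mul_of_nonneg_right ?_ (Real.exp_pos _).le
    linarith
  push_cast at key ⊢
  have key' := mul_le_mul_of_nonneg_right key (Real.exp_pos (kappa163 4 / 4 / 2)).le
  refine le_trans (le_of_eq ?_) (key'.trans (le_of_eq ?_))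
  · ring
  · ring

end Majorants

/-! ## §2 Row (lamf) on the scales: ONE constant for every `m` -/

section Scales

variable {Lc : ℕ} [NeZero Lc]

/-- **ROW (lamf) ON THE SCALES WITH ONE m-INDEPENDENT CONSTANT** [our objects + folklore] — the `hAlamf ∕ hBlamf` binders of
`ChartDefectHeadScales.abs_secondMoment_chartDefect_scales_le_of_rows` (pin `hWlamf := fun _ _ _ _ ↦ rfl`; `Lc` odd): modulo ONE sup letter of the STRAIGHT one-shot kernel for
all scales `hK₀ : ∀ m, Bdd (KInvStep 3 (Lc^m) 0) S₀` (`0 ≤ S₀`; the road's leg at scale `m` is then `Bdd G₀ ((1+16·Lc^m)²·S₀)` — g63 «G0-BDD» `RoadPinKernelBdd.bdd_G₀_of_bdd`) and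
`hcΛ : ∀ m, |cΛ m| ≤ cΛ*`, for every `m` the scale-`m` (lamf) row kernel has absolutely summable (1.22) second moments and
`|secondMoment (Wlamf m) μ ν| ≤ C_lamf* := ((cΛ*∕2)·(S₀·(2·GΛ*·(C_pack·(289·mT*)) + 2·GΛ*·(C_pack·(289·mT*)))))·Σ'_x |x|₁²e^{−(κ′∕16)|x|₁}` — per scale TT32 `decay510_row_lamf_record_of_env`
at `σ_m := κ′∕(16·Lc^m)` (rate `(Lc^m)·σ_m = κ′∕16`) with the envelope `GΛ(Lc^m) ≤ GΛ*` (`Lc^m ≥ 3`, split) or `GΛ₁(1) ≤ GΛ*` (`Lc^m = 1`), the dressing cost `(1+16n)²` absorbed by the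
Λ-pack's `n⁻³` (§1 `packMassConst_dressed_le`), then lit `decay510_mono_const ∕ absMoment₂_of_decay510 ∕ secondMoment_abs_le_of_decay510`. -/
theorem row_lamf_scales (hLc : Odd Lc) (N : ℕ) (cΛ : ℕ → ℝ) {cΛmax : ℝ} (hcΛ : ∀ m : ℕ, |cΛ m| ≤ cΛmax)
    {S₀ : ℝ} (hS₀ : 0 ≤ S₀) (hK₀ : ∀ m : ℕ, Bdd (KInvStep (d := 3) (Lc ^ m) 0) S₀)
    (μ ν : Fin (3 + 1)) :
    (∀ (m : ℕ) (a e : Fin (3 + 1)), AbsMoment₂ (fun z : Site 4 => (1 / 2 : ℝ) * tadpole (coDressKBmAt (ctr 4 (Lc ^ m)) (Lc ^ m) (KInvStep (d := 3) (Lc ^ m) 0))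
        (((comp (diagK fun x b => -(∑ α : Fin (3 + 1), ∑ x' ∈ blockSitesF (Lc ^ m) (blk (Lc ^ m) (legSite (ctr 4 (Lc ^ m)) x b)), colH (coDressKBmAt (ctr 4 (Lc ^ m)) (Lc ^ m) (KInvStep (d := 3) (Lc ^ m) 0)) (Lc ^ m) e z α x' * ((((Lc ^ m : ℕ) : ℝ) ^ 4 / 2) * faceWt (ctrOff 4 (Lc ^ m)) (Lc ^ m) α x'))) (vertexOfK (coDressKBmAt (ctr 4 (Lc ^ m)) (Lc ^ m) (KInvStep (d := 3) (Lc ^ m) 0)) (Lc ^ m) (fun κ u => (((Lc ^ m : ℕ) : ℝ) ^ 4) • wilsonA 3 κ u + (-(((Lc ^ m : ℕ) : ℝ) ^ 8 / 2)) • symVhSAt (ctr 4 (Lc ^ m)) 3 (Lc ^ m) rfl κ u) a 0) - comp (vertexOfK (coDressKBmAt (ctr 4 (Lc ^ m)) (Lc ^ m) (KInvStep (d := 3) (Lc ^ m) 0)) (Lc ^ m) (fun κ u => (((Lc ^ m : ℕ) : ℝ) ^ 4) • wilsonA 3 κ u + (-(((Lc ^ m : ℕ) : ℝ) ^ 8 /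 2)) • symVhSAt (ctr 4 (Lc ^ m)) 3 (Lc ^ m) rfl κ u) a 0) (diagK fun x b => -(∑ α : Fin (3 + 1), ∑ x' ∈ blockSitesF (Lc ^ m) (blk (Lc ^ m) (legSite (ctr 4 (Lc ^ m)) x b)), colH (coDressKBmAt (ctr 4 (Lc ^ m)) (Lc ^ m) (KInvStep (d := 3) (Lc ^ m) 0)) (Lc ^ m) e z α x' * ((((Lc ^ m : ℕ) : ℝ) ^ 4 / 2) * faceWt (ctrOff 4 (Lc ^ m)) (Lc ^ m) α x'))))
              + (comp (diagK fun x b => -(∑ α : Fin (3 + 1), ∑ x' ∈ blockSitesF (Lc ^ m) (blk (Lc ^ m) (legSite (ctr 4 (Lc ^ m)) x b)), colH (coDressKBmAt (ctr 4 (Lc ^ m)) (Lc ^ m) (KInvStep (d := 3) (Lc ^ m) 0)) (Lc ^ m) a 0 α x' * ((((Lc ^ m : ℕ) : ℝ) ^ 4 / 2) * faceWt (ctrOff 4 (Lc ^ m)) (Lc ^ m) α x'))) (vertexOfK (coDressKBmAt (ctr 4 (Lc ^ m)) (Lc ^ m) (KInvStep (d := 3) (Lc ^ m) 0)) (Lc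 ^ m) (fun κ u => (((Lc ^ m : ℕ) : ℝ) ^ 4) • wilsonA 3 κ u + (-(((Lc ^ m : ℕ) : ℝ) ^ 8 / 2)) • symVhSAt (ctr 4 (Lc ^ m)) 3 (Lc ^ m) rfl κ u) e z) - comp (vertexOfK (coDressKBmAt (ctr 4 (Lc ^ m)) (Lc ^ m) (KInvStep (d := 3) (Lc ^ m) 0)) (Lc ^ m) (fun κ u => (((Lc ^ m : ℕ) : ℝ) ^ 4) • wilsonA 3 κ u + (-(((Lc ^ m : ℕ) : ℝ) ^ 8 / 2)) • symVhSAt (ctr 4 (Lc ^ m)) 3 (Lc ^ m) rfl κ u) e z) (diagK fun x b => -(∑ α : Fin (3 + 1), ∑ x' ∈ blockSitesF (Lc ^ m) (blk (Lc ^ m) (legSite (ctr 4 (Lc ^ m)) x b)), colH (coDressKBmAt (ctr 4 (Lc ^ m)) (Lc ^ m) (KInvStep (d := 3) (Lc ^ m) 0)) (Lc ^ m) a 0 α x' * ((((Lc ^ m : ℕ) : ℝ) ^ 4 / 2) * faceWt (ctrOff 4 (Lc ^ m)) (Lc ^ m) α x')))))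
            - ((comp (diagK fun x b => -(∑ α : Fin (3 + 1), ∑ x' ∈ blockSitesF (Lc ^ m) (blk (Lc ^ m) (legSite (ctr 4 (Lc ^ m)) x b)), colH (coDressKBmAt (ctr 4 (Lc ^ m)) (Lc ^ m) (KInvStep (d := 3) (Lc ^ m) 0)) (Lc ^ m) e z α x' * ((((Lc ^ m : ℕ) : ℝ) ^ 4 / 2) * faceWt (ctrOff 4 (Lc ^ m)) (Lc ^ m) α x'))) (vertexOfK (coDressKBmAt (ctr 4 (Lc ^ m)) (Lc ^ m) (KInvStep (d := 3) (Lc ^ m) 0)) (Lc ^ m) (JsB12CombSh0 (Lc := Lc ^ m) hLc.pow N (symTablesAn1S2 3 (Lc ^ m) (cΛ m)) (cΛ m) (-(((Lc ^ m : ℕ) : ℝ) ^ 12 / 4)) 0).S a 0) - comp (vertexOfK (coDressKBmAt (ctr 4 (Lc ^ m)) (Lc ^ m) (KInvStep (d := 3) (Lc ^ m) 0)) (Lc ^ m) (JsB12CombSh0 (Lc := Lc ^ m) hLc.pow N (symTablesAn1S2 3 (Lc ^ m) (cΛ m)) (cΛ m) (-(((Lc ^ m : ℕ) : ℝ) ^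 12 / 4)) 0).S a 0) (diagK fun x b => -(∑ α : Fin (3 + 1), ∑ x' ∈ blockSitesF (Lc ^ m) (blk (Lc ^ m) (legSite (ctr 4 (Lc ^ m)) x b)), colH (coDressKBmAt (ctr 4 (Lc ^ m)) (Lc ^ m) (KInvStep (d := 3) (Lc ^ m) 0)) (Lc ^ m) e z α x' * ((((Lc ^ m : ℕ) : ℝ) ^ 4 / 2) * faceWt (ctrOff 4 (Lc ^ m)) (Lc ^ m) α x'))))
              + (comp (diagK fun x b => -(∑ α : Fin (3 + 1), ∑ x' ∈ blockSitesF (Lc ^ m) (blk (Lc ^ m) (legSite (ctr 4 (Lc ^ m)) x b)), colH (coDressKBmAt (ctr 4 (Lc ^ m)) (Lc ^ m) (KInvStep (d := 3) (Lc ^ m) 0)) (Lc ^ m) a 0 α x' * ((((Lc ^ m : ℕ) : ℝ) ^ 4 / 2) * faceWt (ctrOff 4 (Lc ^ m)) (Lc ^ m) α x'))) (vertexOfK (coDressKBmAt (ctr 4 (Lc ^ m)) (Lc ^ m) (KInvStep (d := 3) (Lc ^ m) 0)) (Lc ^ m) (JsB12CombSh0 (Lc := Lc ^ m) hLc.pow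 N (symTablesAn1S2 3 (Lc ^ m) (cΛ m)) (cΛ m) (-(((Lc ^ m : ℕ) : ℝ) ^ 12 / 4)) 0).S e z) - comp (vertexOfK (coDressKBmAt (ctr 4 (Lc ^ m)) (Lc ^ m) (KInvStep (d := 3) (Lc ^ m) 0)) (Lc ^ m) (JsB12CombSh0 (Lc := Lc ^ m) hLc.pow N (symTablesAn1S2 3 (Lc ^ m) (cΛ m)) (cΛ m) (-(((Lc ^ m : ℕ) : ℝ) ^ 12 / 4)) 0).S e z) (diagK fun x b => -(∑ α : Fin (3 + 1), ∑ x' ∈ blockSitesF (Lc ^ m) (blk (Lc ^ m) (legSite (ctr 4 (Lc ^ m)) x b)), colH (coDressKBmAt (ctr 4 (Lc ^ m)) (Lc ^ m) (KInvStep (d := 3) (Lc ^ m) 0)) (Lc ^ m) a 0 α x' * ((((Lc ^ m : ℕ) : ℝ) ^ 4 / 2) * faceWt (ctrOff 4 (Lc ^ m)) (Lc ^ m) α x')))))))) ∧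
      ∀ m : ℕ, |B12Beta.secondMoment (fun (a e : Fin (3 + 1)) (z : Site 4) => (1 / 2 : ℝ) * tadpole (coDressKBmAt (ctr 4 (Lc ^ m)) (Lc ^ m) (KInvStep (d := 3) (Lc ^ m) 0))
        (((comp (diagK fun x b => -(∑ α : Fin (3 + 1), ∑ x' ∈ blockSitesF (Lc ^ m) (blk (Lc ^ m) (legSite (ctr 4 (Lc ^ m)) x b)), colH (coDressKBmAt (ctr 4 (Lc ^ m)) (Lc ^ m) (KInvStep (d := 3) (Lc ^ m) 0)) (Lc ^ m) e z α x' * ((((Lc ^ m : ℕ) : ℝ) ^ 4 / 2) * faceWt (ctrOff 4 (Lc ^ m)) (Lc ^ m) α x'))) (vertexOfK (coDressKBmAt (ctr 4 (Lc ^ m)) (Lc ^ m) (KInvStep (d := 3) (Lc ^ m) 0)) (Lc ^ m) (fun κ u => (((Lc ^ m : ℕ) : ℝ) ^ 4) • wilsonA 3 κ u + (-(((Lc ^ m : ℕ) : ℝ) ^ 8 / 2)) • symVhSAt (ctr 4 (Lc ^ m)) 3 (Lc ^ m) rfl κ u) a 0) - comp (vertexOfK (coDressKBmAt (ctr 4 (Lc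 ^ m)) (Lc ^ m) (KInvStep (d := 3) (Lc ^ m) 0)) (Lc ^ m) (fun κ u => (((Lc ^ m : ℕ) : ℝ) ^ 4) • wilsonA 3 κ u + (-(((Lc ^ m : ℕ) : ℝ) ^ 8 / 2)) • symVhSAt (ctr 4 (Lc ^ m)) 3 (Lc ^ m) rfl κ u) a 0) (diagK fun x b => -(∑ α : Fin (3 + 1), ∑ x' ∈ blockSitesF (Lc ^ m) (blk (Lc ^ m) (legSite (ctr 4 (Lc ^ m)) x b)), colH (coDressKBmAt (ctr 4 (Lc ^ m)) (Lc ^ m) (KInvStep (d := 3) (Lc ^ m) 0)) (Lc ^ m) e z α x' * ((((Lc ^ m : ℕ) : ℝ) ^ 4 / 2) * faceWt (ctrOff 4 (Lc ^ m)) (Lc ^ m) α x'))))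
              + (comp (diagK fun x b => -(∑ α : Fin (3 + 1), ∑ x' ∈ blockSitesF (Lc ^ m) (blk (Lc ^ m) (legSite (ctr 4 (Lc ^ m)) x b)), colH (coDressKBmAt (ctr 4 (Lc ^ m)) (Lc ^ m) (KInvStep (d := 3) (Lc ^ m) 0)) (Lc ^ m) a 0 α x' * ((((Lc ^ m : ℕ) : ℝ) ^ 4 / 2) * faceWt (ctrOff 4 (Lc ^ m)) (Lc ^ m) α x'))) (vertexOfK (coDressKBmAt (ctr 4 (Lc ^ m)) (Lc ^ m) (KInvStep (d := 3) (Lc ^ m) 0)) (Lc ^ m) (fun κ u => (((Lc ^ m : ℕ) : ℝ) ^ 4) • wilsonA 3 κ u + (-(((Lc ^ m : ℕ) : ℝ) ^ 8 / 2)) • symVhSAt (ctr 4 (Lc ^ m)) 3 (Lc ^ m) rfl κ u) e z) - comp (vertexOfK (coDressKBmAt (ctr 4 (Lc ^ m)) (Lc ^ m) (KInvStep (d := 3) (Lc ^ m) 0)) (Lc ^ m) (fun κ u => (((Lc ^ m : ℕ) : ℝ) ^ 4) • wilsonA 3 κ u + (-(((Lc ^ m : ℕ) : ℝ) ^ 8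 / 2)) • symVhSAt (ctr 4 (Lc ^ m)) 3 (Lc ^ m) rfl κ u) e z) (diagK fun x b => -(∑ α : Fin (3 + 1), ∑ x' ∈ blockSitesF (Lc ^ m) (blk (Lc ^ m) (legSite (ctr 4 (Lc ^ m)) x b)), colH (coDressKBmAt (ctr 4 (Lc ^ m)) (Lc ^ m) (KInvStep (d := 3) (Lc ^ m) 0)) (Lc ^ m) a 0 α x' * ((((Lc ^ m : ℕ) : ℝ) ^ 4 / 2) * faceWt (ctrOff 4 (Lc ^ m)) (Lc ^ m) α x')))))
            - ((comp (diagK fun x b => -(∑ α : Fin (3 + 1), ∑ x' ∈ blockSitesF (Lc ^ m) (blk (Lc ^ m) (legSite (ctr 4 (Lc ^ m)) x b)), colH (coDressKBmAt (ctr 4 (Lc ^ m)) (Lc ^ m) (KInvStep (d := 3) (Lc ^ m) 0)) (Lc ^ m) e z α x' * ((((Lc ^ m : ℕ) : ℝ) ^ 4 / 2) * faceWt (ctrOff 4 (Lc ^ m)) (Lc ^ m) α x'))) (vertexOfK (coDressKBmAt (ctr 4 (Lc ^ m)) (Lc ^ m) (KInvStep (d := 3) (Lc ^ m) 0)) (Lc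 ^ m) (JsB12CombSh0 (Lc := Lc ^ m) hLc.pow N (symTablesAn1S2 3 (Lc ^ m) (cΛ m)) (cΛ m) (-(((Lc ^ m : ℕ) : ℝ) ^ 12 / 4)) 0).S a 0) - comp (vertexOfK (coDressKBmAt (ctr 4 (Lc ^ m)) (Lc ^ m) (KInvStep (d := 3) (Lc ^ m) 0)) (Lc ^ m) (JsB12CombSh0 (Lc := Lc ^ m) hLc.pow N (symTablesAn1S2 3 (Lc ^ m) (cΛ m)) (cΛ m) (-(((Lc ^ m : ℕ) : ℝ) ^ 12 / 4)) 0).S a 0) (diagK fun x b => -(∑ α : Fin (3 + 1), ∑ x' ∈ blockSitesF (Lc ^ m) (blk (Lc ^ m) (legSite (ctr 4 (Lc ^ m)) x b)), colH (coDressKBmAt (ctr 4 (Lc ^ m)) (Lc ^ m) (KInvStep (d := 3) (Lc ^ m) 0)) (Lc ^ m) e z α x' * ((((Lc ^ m : ℕ) : ℝ) ^ 4 / 2) * faceWt (ctrOff 4 (Lc ^ m)) (Lc ^ m) α x'))))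
              + (comp (diagK fun x b => -(∑ α : Fin (3 + 1), ∑ x' ∈ blockSitesF (Lc ^ m) (blk (Lc ^ m) (legSite (ctr 4 (Lc ^ m)) x b)), colH (coDressKBmAt (ctr 4 (Lc ^ m)) (Lc ^ m) (KInvStep (d := 3) (Lc ^ m) 0)) (Lc ^ m) a 0 α x' * ((((Lc ^ m : ℕ) : ℝ) ^ 4 / 2) * faceWt (ctrOff 4 (Lc ^ m)) (Lc ^ m) α x'))) (vertexOfK (coDressKBmAt (ctr 4 (Lc ^ m)) (Lc ^ m) (KInvStep (d := 3) (Lc ^ m) 0)) (Lc ^ m) (JsB12CombSh0 (Lc := Lc ^ m) hLc.pow N (symTablesAn1S2 3 (Lc ^ m) (cΛ m)) (cΛ m) (-(((Lc ^ m : ℕ) : ℝ) ^ 12 / 4)) 0).S e z) - comp (vertexOfK (coDressKBmAt (ctr 4 (Lc ^ m)) (Lc ^ m) (KInvStep (d := 3) (Lc ^ m) 0)) (Lc ^ m) (JsB12CombSh0 (Lc := Lc ^ m) hLc.pow N (symTablesAn1S2 3 (Lc ^ m) (cΛ m)) (cΛ m) (-(((Lc ^ m : ℕ) : ℝ) ^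 12 / 4)) 0).S e z) (diagK fun x b => -(∑ α : Fin (3 + 1), ∑ x' ∈ blockSitesF (Lc ^ m) (blk (Lc ^ m) (legSite (ctr 4 (Lc ^ m)) x b)), colH (coDressKBmAt (ctr 4 (Lc ^ m)) (Lc ^ m) (KInvStep (d := 3) (Lc ^ m) 0)) (Lc ^ m) a 0 α x' * ((((Lc ^ m : ℕ) : ℝ) ^ 4 / 2) * faceWt (ctrOff 4 (Lc ^ m)) (Lc ^ m) α x'))))))) μ ν|
        ≤ ((cΛmax / 2) * (S₀ * (2 * ((8 * (8 * (MD163 4 * periodConst (kappa163 4) 3) * Real.exp (kappa163 4 / 4)) + 16 * ((MG163 4 * periodConst (kappa163 4) 3) * (1 + 8 * (1 + Real.exp (kappa163 4 / 4))) * Real.exp (kappa163 4 / 4))) * Real.exp (2 * (kappa163 4 / 4))) * ((4 * ((MG163 4 * periodConst (kappa163 4) 3) * (1 + 8 * (1 + Real.exp (kappa163 4 / 4))) * Real.exp (kappa163 4 / 4))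
            * (1 + 16 / (kappa163 4 / 4)) ^ 4) * (289 * (((4 * ((3 : ℝ) ^ (3 + 1) * ((3 + 1 : ℕ) : ℝ) * (16 * ((3 + 1 : ℕ) : ℝ)) * (MG163 4 * periodConst (kappa163 4) 3)
              * Real.exp (kappa163 4 / 4) * Real.exp (kappa163 4 / 4) * Real.exp (kappa163 4 / 4))
            * Real.exp (kappa163 4 / 4 / 2) * Zl 4 (kappa163 4 / 4 / 8)) * (2 * 100 * Real.exp (kappa163 4 / 4))) * Real.exp (kappa163 4 / 4 / 2))))
            + 2 * ((8 * (8 * (MD163 4 * periodConst (kappa163 4) 3) * Real.exp (kappa163 4 / 4)) + 16 * ((MG163 4 * periodConst (kappa163 4) 3) * (1 + 8 * (1 + Real.exp (kappa163 4 / 4))) * Real.exp (kappa163 4 / 4))) * Real.exp (2 * (kappa163 4 / 4))) * ((4 * ((MG163 4 * periodConst (kappa163 4) 3) * (1 + 8 * (1 + Real.exp (kappa163 4 / 4))) * Real.exp (kappa163 4 / 4))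
            * (1 + 16 / (kappa163 4 / 4)) ^ 4) * (289 * (((4 * ((3 : ℝ) ^ (3 + 1) * ((3 + 1 : ℕ) : ℝ) * (16 * ((3 + 1 : ℕ) : ℝ)) * (MG163 4 * periodConst (kappa163 4) 3)
              * Real.exp (kappa163 4 / 4) * Real.exp (kappa163 4 / 4) * Real.exp (kappa163 4 / 4))
            * Real.exp (kappa163 4 / 4 / 2) * Zl 4 (kappa163 4 / 4 / 8)) * (2 * 100 * Real.exp (kappa163 4 / 4))) * Real.exp (kappa163 4 / 4 / 2)))))))
          * ∑' x : Site 4, l1 x ^ 2 * Real.exp (-(kappa163 4 / 4 / 16) * l1 x) := by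
  have hκ : 0 < kappa163 4 := kappa163_pos 4
  have hrate : (0 : ℝ) < kappa163 4 / 4 / 16 := by positivity
  have hGs0 : 0 ≤ ((8 * (8 * (MD163 4 * periodConst (kappa163 4) 3) * Real.exp (kappa163 4 / 4)) + 16 * ((MG163 4 * periodConst (kappa163 4) 3) * (1 + 8 * (1 + Real.exp (kappa163 4 / 4))) * Real.exp (kappa163 4 / 4))) * Real.exp (2 * (kappa163 4 / 4))) := faceLamGenStar_nonneg
  have hCP : 0 ≤ (4 * ((MG163 4 * periodConst (kappa163 4) 3) * (1 + 8 * (1 + Real.exp (kappa163 4 / 4))) * Real.exp (kappa163 4 / 4))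
            * (1 + 16 / (kappa163 4 / 4)) ^ 4) := by
    have := cG_nonneg
    positivity
  -- per scale: the row at the n-free rate `κ′/16` with the m-independent constant
  have key : ∀ (m : ℕ) (a e : Fin (3 + 1)), Decay510 (fun z : Site 4 => (1 / 2 : ℝ) * tadpole (coDressKBmAt (ctr 4 (Lc ^ m)) (Lc ^ m) (KInvStep (d := 3) (Lc ^ m) 0))
        (((comp (diagK fun x b => -(∑ α : Fin (3 + 1), ∑ x' ∈ blockSitesF (Lc ^ m) (blk (Lc ^ m) (legSite (ctr 4 (Lc ^ m)) x b)), colH (coDressKBmAt (ctr 4 (Lc ^ m)) (Lc ^ m) (KInvStep (d := 3) (Lc ^ m) 0)) (Lc ^ m) e z α x' * ((((Lc ^ m : ℕ) : ℝ) ^ 4 / 2) * faceWt (ctrOff 4 (Lc ^ m)) (Lc ^ m) α x'))) (vertexOfK (coDressKBmAt (ctr 4 (Lc ^ m)) (Lc ^ m) (KInvStep (d := 3) (Lc ^ m) 0)) (Lc ^ m) (fun κ u => (((Lc ^ m : ℕ) : ℝ) ^ 4) • wilsonA 3 κ u + (-(((Lc ^ m : ℕ) : ℝ) ^ 8 / 2))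 • symVhSAt (ctr 4 (Lc ^ m)) 3 (Lc ^ m) rfl κ u) a 0) - comp (vertexOfK (coDressKBmAt (ctr 4 (Lc ^ m)) (Lc ^ m) (KInvStep (d := 3) (Lc ^ m) 0)) (Lc ^ m) (fun κ u => (((Lc ^ m : ℕ) : ℝ) ^ 4) • wilsonA 3 κ u + (-(((Lc ^ m : ℕ) : ℝ) ^ 8 / 2)) • symVhSAt (ctr 4 (Lc ^ m)) 3 (Lc ^ m) rfl κ u) a 0) (diagK fun x b => -(∑ α : Fin (3 + 1), ∑ x' ∈ blockSitesF (Lc ^ m) (blk (Lc ^ m) (legSite (ctr 4 (Lc ^ m)) x b)), colH (coDressKBmAt (ctr 4 (Lc ^ m)) (Lc ^ m) (KInvStep (d := 3) (Lc ^ m) 0)) (Lc ^ m) e z α x' * ((((Lc ^ m : ℕ) : ℝ) ^ 4 / 2) * faceWt (ctrOff 4 (Lc ^ m)) (Lc ^ m) α x'))))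
              + (comp (diagK fun x b => -(∑ α : Fin (3 + 1), ∑ x' ∈ blockSitesF (Lc ^ m) (blk (Lc ^ m) (legSite (ctr 4 (Lc ^ m)) x b)), colH (coDressKBmAt (ctr 4 (Lc ^ m)) (Lc ^ m) (KInvStep (d := 3) (Lc ^ m) 0)) (Lc ^ m) a 0 α x' * ((((Lc ^ m : ℕ) : ℝ) ^ 4 / 2) * faceWt (ctrOff 4 (Lc ^ m)) (Lc ^ m) α x'))) (vertexOfK (coDressKBmAt (ctr 4 (Lc ^ m)) (Lc ^ m) (KInvStep (d := 3) (Lc ^ m) 0)) (Lc ^ m) (fun κ u => (((Lc ^ m : ℕ) : ℝ) ^ 4) • wilsonA 3 κ u + (-(((Lc ^ m : ℕ) : ℝ) ^ 8 / 2)) • symVhSAt (ctr 4 (Lc ^ m)) 3 (Lc ^ m) rfl κ u) e z) - comp (vertexOfK (coDressKBmAt (ctr 4 (Lc ^ m)) (Lc ^ m) (KInvStep (d := 3) (Lc ^ m) 0)) (Lc ^ m) (fun κ u => (((Lc ^ m : ℕ) : ℝ) ^ 4) • wilsonA 3 κ u + (-(((Lc ^ m : ℕ) : ℝ) ^ 8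 / 2)) • symVhSAt (ctr 4 (Lc ^ m)) 3 (Lc ^ m) rfl κ u) e z) (diagK fun x b => -(∑ α : Fin (3 + 1), ∑ x' ∈ blockSitesF (Lc ^ m) (blk (Lc ^ m) (legSite (ctr 4 (Lc ^ m)) x b)), colH (coDressKBmAt (ctr 4 (Lc ^ m)) (Lc ^ m) (KInvStep (d := 3) (Lc ^ m) 0)) (Lc ^ m) a 0 α x' * ((((Lc ^ m : ℕ) : ℝ) ^ 4 / 2) * faceWt (ctrOff 4 (Lc ^ m)) (Lc ^ m) α x')))))
            - ((comp (diagK fun x b => -(∑ α : Fin (3 + 1), ∑ x' ∈ blockSitesF (Lc ^ m) (blk (Lc ^ m) (legSite (ctr 4 (Lc ^ m)) x b)), colH (coDressKBmAt (ctr 4 (Lc ^ m)) (Lc ^ m) (KInvStep (d := 3) (Lc ^ m) 0)) (Lc ^ m) e z α x' * ((((Lc ^ m : ℕ) : ℝ) ^ 4 / 2) * faceWt (ctrOff 4 (Lc ^ m)) (Lc ^ m) α x'))) (vertexOfK (coDressKBmAt (ctr 4 (Lc ^ m)) (Lc ^ m) (KInvStep (d := 3) (Lc ^ m) 0)) (Lc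 ^ m) (JsB12CombSh0 (Lc := Lc ^ m) hLc.pow N (symTablesAn1S2 3 (Lc ^ m) (cΛ m)) (cΛ m) (-(((Lc ^ m : ℕ) : ℝ) ^ 12 / 4)) 0).S a 0) - comp (vertexOfK (coDressKBmAt (ctr 4 (Lc ^ m)) (Lc ^ m) (KInvStep (d := 3) (Lc ^ m) 0)) (Lc ^ m) (JsB12CombSh0 (Lc := Lc ^ m) hLc.pow N (symTablesAn1S2 3 (Lc ^ m) (cΛ m)) (cΛ m) (-(((Lc ^ m : ℕ) : ℝ) ^ 12 / 4)) 0).S a 0) (diagK fun x b => -(∑ α : Fin (3 + 1), ∑ x' ∈ blockSitesF (Lc ^ m) (blk (Lc ^ m) (legSite (ctr 4 (Lc ^ m)) x b)), colH (coDressKBmAt (ctr 4 (Lc ^ m)) (Lc ^ m) (KInvStep (d := 3) (Lc ^ m) 0)) (Lc ^ m) e z α x' * ((((Lc ^ m : ℕ) : ℝ) ^ 4 / 2) * faceWt (ctrOff 4 (Lc ^ m)) (Lc ^ m) α x'))))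
              + (comp (diagK fun x b => -(∑ α : Fin (3 + 1), ∑ x' ∈ blockSitesF (Lc ^ m) (blk (Lc ^ m) (legSite (ctr 4 (Lc ^ m)) x b)), colH (coDressKBmAt (ctr 4 (Lc ^ m)) (Lc ^ m) (KInvStep (d := 3) (Lc ^ m) 0)) (Lc ^ m) a 0 α x' * ((((Lc ^ m : ℕ) : ℝ) ^ 4 / 2) * faceWt (ctrOff 4 (Lc ^ m)) (Lc ^ m) α x'))) (vertexOfK (coDressKBmAt (ctr 4 (Lc ^ m)) (Lc ^ m) (KInvStep (d := 3) (Lc ^ m) 0)) (Lc ^ m) (JsB12CombSh0 (Lc := Lc ^ m) hLc.pow N (symTablesAn1S2 3 (Lc ^ m) (cΛ m)) (cΛ m) (-(((Lc ^ m : ℕ) : ℝ) ^ 12 / 4)) 0).S e z) - comp (vertexOfK (coDressKBmAt (ctr 4 (Lc ^ m)) (Lc ^ m) (KInvStep (d := 3) (Lc ^ m) 0)) (Lc ^ m) (JsB12CombSh0 (Lc := Lc ^ m) hLc.pow N (symTablesAn1S2 3 (Lc ^ m) (cΛ m)) (cΛ m) (-(((Lc ^ m : ℕ) : ℝ) ^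 12 / 4)) 0).S e z) (diagK fun x b => -(∑ α : Fin (3 + 1), ∑ x' ∈ blockSitesF (Lc ^ m) (blk (Lc ^ m) (legSite (ctr 4 (Lc ^ m)) x b)), colH (coDressKBmAt (ctr 4 (Lc ^ m)) (Lc ^ m) (KInvStep (d := 3) (Lc ^ m) 0)) (Lc ^ m) a 0 α x' * ((((Lc ^ m : ℕ) : ℝ) ^ 4 / 2) * faceWt (ctrOff 4 (Lc ^ m)) (Lc ^ m) α x')))))))
      ((cΛmax / 2) * (S₀ * (2 * ((8 * (8 * (MD163 4 * periodConst (kappa163 4) 3) * Real.exp (kappa163 4 / 4)) + 16 * ((MG163 4 * periodConst (kappa163 4) 3) * (1 + 8 * (1 + Real.exp (kappa163 4 / 4))) * Real.exp (kappa163 4 / 4))) * Real.exp (2 * (kappa163 4 / 4))) * ((4 * ((MG163 4 * periodConst (kappa163 4) 3) * (1 + 8 * (1 + Real.exp (kappa163 4 / 4))) * Real.exp (kappa163 4 / 4))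
            * (1 + 16 / (kappa163 4 / 4)) ^ 4) * (289 * (((4 * ((3 : ℝ) ^ (3 + 1) * ((3 + 1 : ℕ) : ℝ) * (16 * ((3 + 1 : ℕ) : ℝ)) * (MG163 4 * periodConst (kappa163 4) 3)
              * Real.exp (kappa163 4 / 4) * Real.exp (kappa163 4 / 4) * Real.exp (kappa163 4 / 4))
            * Real.exp (kappa163 4 / 4 / 2) * Zl 4 (kappa163 4 / 4 / 8)) * (2 * 100 * Real.exp (kappa163 4 / 4))) * Real.exp (kappa163 4 / 4 / 2))))
            + 2 * ((8 * (8 * (MD163 4 * periodConst (kappa163 4) 3) * Real.exp (kappa163 4 / 4)) + 16 * ((MG163 4 * periodConst (kappa163 4) 3) * (1 + 8 * (1 + Real.exp (kappa163 4 / 4))) * Real.exp (kappa163 4 / 4))) * Real.exp (2 * (kappa163 4 / 4))) * ((4 * ((MG163 4 * periodConst (kappa163 4) 3) * (1 + 8 * (1 + Real.exp (kappa163 4 / 4))) * Real.exp (kappa163 4 / 4))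
            * (1 + 16 / (kappa163 4 / 4)) ^ 4) * (289 * (((4 * ((3 : ℝ) ^ (3 + 1) * ((3 + 1 : ℕ) : ℝ) * (16 * ((3 + 1 : ℕ) : ℝ)) * (MG163 4 * periodConst (kappa163 4) 3)
              * Real.exp (kappa163 4 / 4) * Real.exp (kappa163 4 / 4) * Real.exp (kappa163 4 / 4))
            * Real.exp (kappa163 4 / 4 / 2) * Zl 4 (kappa163 4 / 4 / 8)) * (2 * 100 * Real.exp (kappa163 4 / 4))) * Real.exp (kappa163 4 / 4 / 2))))))) (kappa163 4 / 4 / 16) := by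
    intro m a e
    have hn1 : 1 ≤ Lc ^ m := Nat.one_le_iff_ne_zero.2 (pow_ne_zero _ (NeZero.ne Lc))
    have hnpos : (0 : ℝ) < ((Lc ^ m : ℕ) : ℝ) := by exact_mod_cast hn1
    have hodd : Odd (Lc ^ m) := hLc.pow
    -- the generator envelope, by blocking (`Lc^m ≥ 3`: split; `Lc^m = 1`: one envelope), majorised by `GΛ*`
    have hg : ∀ (μ' : Fin (3 + 1)) (y x : Site 4) (b : Fib 3),
        |-(∑ α : Fin (3 + 1), ∑ x' ∈ blockSitesF (Lc ^ m) (blk (Lc ^ m) (legSite (ctr 4 (Lc ^ m)) x b)), colH (coDressKBmAt (ctr 4 (Lc ^ m)) (Lc ^ m) (KInvStep (d := 3) (Lc ^ m) 0)) (Lc ^ m) μ' y α x' * ((((Lc ^ m : ℕ) : ℝ) ^ 4 / 2) * faceWt (ctrOff 4 (Lc ^ m)) (Lc ^ m) α x'))|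
          ≤ ((8 * (8 * (MD163 4 * periodConst (kappa163 4) 3) * Real.exp (kappa163 4 / 4)) + 16 * ((MG163 4 * periodConst (kappa163 4) 3) * (1 + 8 * (1 + Real.exp (kappa163 4 / 4))) * Real.exp (kappa163 4 / 4))) * Real.exp (2 * (kappa163 4 / 4))) * Real.exp (-(kappa163 4 / 4 / (4 * ((Lc ^ m : ℕ) : ℝ))) * l1 (x - ((Lc ^ m : ℕ) : ℤ) • y)) := by
      intro μ' y x b
      by_cases h3 : 3 ≤ Lc ^ m
      · exact (abs_faceLamGen_G₀_legSite_le (Lc ^ m) h3 μ' y x b).trans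
          (mul_le_mul_of_nonneg_right (faceLamGenConst_le (Lc ^ m) hn1) (Real.exp_pos _).le)
      · have h1 : Lc ^ m = 1 := by
          obtain ⟨k, hk⟩ := hodd
          omega
        refine (abs_faceLamGen_G₀_legSite_le_one (Lc ^ m) hn1 μ' y x b).trans (mul_le_mul_of_nonneg_right ?_ (Real.exp_pos _).le)
        refine (faceLamGenConstOne_le (Lc ^ m) hn1).trans (le_of_eq ?_)
        rw [h1]; push_cast; rw [one_mul]
    have hσpos : (0 : ℝ) < kappa163 4 / 4 / (16 * ((Lc ^ m : ℕ) : ℝ)) := by positivity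
    -- the road's leg at scale `m` from the straight kernel's sup letter (g63 «G0-BDD»)
    have hG := bdd_G₀_of_bdd (Lc ^ m) (hK₀ m)
    have hS : (0 : ℝ) ≤ (1 + 4 * (((3 : ℝ) + 1) * ((Lc ^ m : ℕ) : ℝ))) ^ 2 * S₀ := by positivity
    have h := decay510_row_lamf_record_of_env (Lc ^ m) hodd hGs0 hg N (cΛ m) hG hS hσpos le_rfl a e
    -- the rate is `κ′/16` at every scale
    have erate : ((Lc ^ m : ℕ) : ℝ) * (kappa163 4 / 4 / (16 * ((Lc ^ m : ℕ) : ℝ))) = kappa163 4 / 4 / 16 := by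
      field_simp
    rw [erate] at h
    -- the constant is majorised uniformly in `m` (atoms abstracted before the algebra)
    have hMT := packMassConst_dressed_le (Lc ^ m) hn1
    have hMT0 := packMassConst_nonneg (Lc ^ m) hσpos.le le_rfl
    have hc := hcΛ m
    set G : ℝ := ((8 * (8 * (MD163 4 * periodConst (kappa163 4) 3) * Real.exp (kappa163 4 / 4)) + 16 * ((MG163 4 * periodConst (kappa163 4) 3) * (1 + 8 * (1 + Real.exp (kappa163 4 / 4))) * Real.exp (kappa163 4 / 4))) * Real.exp (2 * (kappa163 4 / 4))) with hGdef
    set CP : ℝ := (4 * ((MG163 4 * periodConst (kappa163 4) 3) * (1 + 8 * (1 + Real.exp (kappa163 4 / 4))) * Real.exp (kappa163 4 / 4))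
            * (1 + 16 / (kappa163 4 / 4)) ^ 4) with hCPdef
    set MTs : ℝ := (((4 * ((3 : ℝ) ^ (3 + 1) * ((3 + 1 : ℕ) : ℝ) * (16 * ((3 + 1 : ℕ) : ℝ)) * (MG163 4 * periodConst (kappa163 4) 3)
              * Real.exp (kappa163 4 / 4) * Real.exp (kappa163 4 / 4) * Real.exp (kappa163 4 / 4))
            * Real.exp (kappa163 4 / 4 / 2) * Zl 4 (kappa163 4 / 4 / 8)) * (2 * 100 * Real.exp (kappa163 4 / 4))) * Real.exp (kappa163 4 / 4 / 2)) with hMTsdef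
    set MT : ℝ := (((((Lc ^ m : ℕ) : ℝ) ^ 5)⁻¹ * (4 * ((3 : ℝ) ^ (3 + 1) * ((3 + 1 : ℕ) : ℝ) * (16 * ((3 + 1 : ℕ) : ℝ)) * (MG163 4 * periodConst (kappa163 4) 3)
              * Real.exp (kappa163 4 / 4) * Real.exp (kappa163 4 / 4) * Real.exp (kappa163 4 / 4))
            * Real.exp (kappa163 4 / 4 / 2) * Zl 4 (kappa163 4 / 4 / 8)) * (2 * (ell (3 + 1) (Lc ^ m) : ℝ) ^ 2 * Real.exp ((kappa163 4 / 4 / (16 * ((Lc ^ m : ℕ) : ℝ))) * (4 * ((((3 : ℕ) : ℝ) + 1) * ((Lc ^ m : ℕ) : ℝ)))))) * Real.exp (kappa163 4 / 4 / 2)) with hMTdef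
    set A : ℝ := (1 + 4 * (((3 : ℝ) + 1) * ((Lc ^ m : ℕ) : ℝ))) ^ 2 with hAdef
    refine decay510_mono_const h ?_
    have hMTs0 : 0 ≤ 289 * MTs := le_trans (mul_nonneg (sq_nonneg _) hMT0) hMT
    have h1 : CP * (A * MT) ≤ CP * (289 * MTs) := mul_le_mul_of_nonneg_left hMT hCP
    have h2 : 2 * G * (CP * (A * MT)) ≤ 2 * G * (CP * (289 * MTs)) := mul_le_mul_of_nonneg_left h1 (mul_nonneg (by norm_num) hGs0)
    have hb : 0 ≤ 2 * G * (CP * (289 * MTs)) := mul_nonneg (mul_nonneg (by norm_num) hGs0) (mul_nonneg hCP hMTs0)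
    have h3 := mul_le_mul_of_nonneg_left (add_le_add h2 h2) hS₀
    calc (|cΛ m| / 2) * (A * S₀ * (2 * G * (CP * MT) + 2 * G * (CP * MT)))
        = (|cΛ m| / 2) * (S₀ * (2 * G * (CP * (A * MT)) + 2 * G * (CP * (A * MT)))) := by ring
      _ ≤ (|cΛ m| / 2) * (S₀ * (2 * G * (CP * (289 * MTs)) + 2 * G * (CP * (289 * MTs)))) := mul_le_mul_of_nonneg_left h3 (by positivity)
      _ ≤ (cΛmax / 2) * (S₀ * (2 * G * (CP * (289 * MTs)) + 2 * G * (CP * (289 * MTs)))) :=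
          mul_le_mul_of_nonneg_right (by linarith) (mul_nonneg hS₀ (add_nonneg hb hb))
  refine ⟨fun m a e => absMoment₂_of_decay510 hrate (key m a e), fun m => ?_⟩
  exact (secondMoment_abs_le_of_decay510 (P := fun (a e : Fin (3 + 1)) (z : Site 4) => (1 / 2 : ℝ) * tadpole (coDressKBmAt (ctr 4 (Lc ^ m)) (Lc ^ m) (KInvStep (d := 3) (Lc ^ m) 0))
        (((comp (diagK fun x b => -(∑ α : Fin (3 + 1), ∑ x' ∈ blockSitesF (Lc ^ m) (blk (Lc ^ m) (legSite (ctr 4 (Lc ^ m)) x b)), colH (coDressKBmAt (ctr 4 (Lc ^ m)) (Lc ^ m) (KInvStep (d := 3) (Lc ^ m) 0)) (Lc ^ m) e z α x' * ((((Lc ^ m : ℕ) : ℝ) ^ 4 / 2) * faceWt (ctrOff 4 (Lc ^ m)) (Lc ^ m) α x'))) (vertexOfK (coDressKBmAt (ctr 4 (Lc ^ m)) (Lc ^ m) (KInvStep (d := 3) (Lc ^ m) 0)) (Lc ^ m) (fun κ u => (((Lc ^ m : ℕ) : ℝ) ^ 4) • wilsonA 3 κ u + (-(((Lc ^ m : ℕ)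 : ℝ) ^ 8 / 2)) • symVhSAt (ctr 4 (Lc ^ m)) 3 (Lc ^ m) rfl κ u) a 0) - comp (vertexOfK (coDressKBmAt (ctr 4 (Lc ^ m)) (Lc ^ m) (KInvStep (d := 3) (Lc ^ m) 0)) (Lc ^ m) (fun κ u => (((Lc ^ m : ℕ) : ℝ) ^ 4) • wilsonA 3 κ u + (-(((Lc ^ m : ℕ) : ℝ) ^ 8 / 2)) • symVhSAt (ctr 4 (Lc ^ m)) 3 (Lc ^ m) rfl κ u) a 0) (diagK fun x b => -(∑ α : Fin (3 + 1), ∑ x' ∈ blockSitesF (Lc ^ m) (blk (Lc ^ m) (legSite (ctr 4 (Lc ^ m)) x b)), colH (coDressKBmAt (ctr 4 (Lc ^ m)) (Lc ^ m) (KInvStep (d := 3) (Lc ^ m) 0)) (Lc ^ m) e z α x' * ((((Lc ^ m : ℕ) : ℝ) ^ 4 / 2) * faceWt (ctrOff 4 (Lc ^ m)) (Lc ^ m) α x'))))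
              + (comp (diagK fun x b => -(∑ α : Fin (3 + 1), ∑ x' ∈ blockSitesF (Lc ^ m) (blk (Lc ^ m) (legSite (ctr 4 (Lc ^ m)) x b)), colH (coDressKBmAt (ctr 4 (Lc ^ m)) (Lc ^ m) (KInvStep (d := 3) (Lc ^ m) 0)) (Lc ^ m) a 0 α x' * ((((Lc ^ m : ℕ) : ℝ) ^ 4 / 2) * faceWt (ctrOff 4 (Lc ^ m)) (Lc ^ m) α x'))) (vertexOfK (coDressKBmAt (ctr 4 (Lc ^ m)) (Lc ^ m) (KInvStep (d := 3) (Lc ^ m) 0)) (Lc ^ m) (fun κ u => (((Lc ^ m : ℕ) : ℝ) ^ 4) • wilsonA 3 κ u + (-(((Lc ^ m : ℕ) : ℝ) ^ 8 / 2)) • symVhSAt (ctr 4 (Lc ^ m)) 3 (Lc ^ m) rfl κ u) e z) - comp (vertexOfK (coDressKBmAt (ctr 4 (Lc ^ m)) (Lc ^ m) (KInvStep (d := 3) (Lc ^ m) 0)) (Lc ^ m) (fun κ u => (((Lc ^ m : ℕ) : ℝ) ^ 4) • wilsonA 3 κ u + (-(((Lc ^ m : ℕ) : ℝ) ^ 8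 / 2)) • symVhSAt (ctr 4 (Lc ^ m)) 3 (Lc ^ m) rfl κ u) e z) (diagK fun x b => -(∑ α : Fin (3 + 1), ∑ x' ∈ blockSitesF (Lc ^ m) (blk (Lc ^ m) (legSite (ctr 4 (Lc ^ m)) x b)), colH (coDressKBmAt (ctr 4 (Lc ^ m)) (Lc ^ m) (KInvStep (d := 3) (Lc ^ m) 0)) (Lc ^ m) a 0 α x' * ((((Lc ^ m : ℕ) : ℝ) ^ 4 / 2) * faceWt (ctrOff 4 (Lc ^ m)) (Lc ^ m) α x')))))
            - ((comp (diagK fun x b => -(∑ α : Fin (3 + 1), ∑ x' ∈ blockSitesF (Lc ^ m) (blk (Lc ^ m) (legSite (ctr 4 (Lc ^ m)) x b)), colH (coDressKBmAt (ctr 4 (Lc ^ m)) (Lc ^ m) (KInvStep (d := 3) (Lc ^ m) 0)) (Lc ^ m) e z α x' * ((((Lc ^ m : ℕ) : ℝ) ^ 4 / 2) * faceWt (ctrOff 4 (Lc ^ m)) (Lc ^ m) α x'))) (vertexOfK (coDressKBmAt (ctr 4 (Lc ^ m)) (Lc ^ m) (KInvStep (d := 3) (Lc ^ m) 0)) (Lc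 ^ m) (JsB12CombSh0 (Lc := Lc ^ m) hLc.pow N (symTablesAn1S2 3 (Lc ^ m) (cΛ m)) (cΛ m) (-(((Lc ^ m : ℕ) : ℝ) ^ 12 / 4)) 0).S a 0) - comp (vertexOfK (coDressKBmAt (ctr 4 (Lc ^ m)) (Lc ^ m) (KInvStep (d := 3) (Lc ^ m) 0)) (Lc ^ m) (JsB12CombSh0 (Lc := Lc ^ m) hLc.pow N (symTablesAn1S2 3 (Lc ^ m) (cΛ m)) (cΛ m) (-(((Lc ^ m : ℕ) : ℝ) ^ 12 / 4)) 0).S a 0) (diagK fun x b => -(∑ α : Fin (3 + 1), ∑ x' ∈ blockSitesF (Lc ^ m) (blk (Lc ^ m) (legSite (ctr 4 (Lc ^ m)) x b)), colH (coDressKBmAt (ctr 4 (Lc ^ m)) (Lc ^ m) (KInvStep (d := 3) (Lc ^ m) 0)) (Lc ^ m) e z α x' * ((((Lc ^ m : ℕ) : ℝ) ^ 4 / 2) * faceWt (ctrOff 4 (Lc ^ m)) (Lc ^ m) α x'))))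
              + (comp (diagK fun x b => -(∑ α : Fin (3 + 1), ∑ x' ∈ blockSitesF (Lc ^ m) (blk (Lc ^ m) (legSite (ctr 4 (Lc ^ m)) x b)), colH (coDressKBmAt (ctr 4 (Lc ^ m)) (Lc ^ m) (KInvStep (d := 3) (Lc ^ m) 0)) (Lc ^ m) a 0 α x' * ((((Lc ^ m : ℕ) : ℝ) ^ 4 / 2) * faceWt (ctrOff 4 (Lc ^ m)) (Lc ^ m) α x'))) (vertexOfK (coDressKBmAt (ctr 4 (Lc ^ m)) (Lc ^ m) (KInvStep (d := 3) (Lc ^ m) 0)) (Lc ^ m) (JsB12CombSh0 (Lc := Lc ^ m) hLc.pow N (symTablesAn1S2 3 (Lc ^ m) (cΛ m)) (cΛ m) (-(((Lc ^ m : ℕ) : ℝ) ^ 12 / 4)) 0).S e z) - comp (vertexOfK (coDressKBmAt (ctr 4 (Lc ^ m)) (Lc ^ m) (KInvStep (d := 3) (Lc ^ m) 0)) (Lc ^ m) (JsB12CombSh0 (Lc := Lc ^ m) hLc.pow N (symTablesAn1S2 3 (Lc ^ m) (cΛ m)) (cΛ m) (-(((Lc ^ m : ℕ) : ℝ) ^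 12 / 4)) 0).S e z) (diagK fun x b => -(∑ α : Fin (3 + 1), ∑ x' ∈ blockSitesF (Lc ^ m) (blk (Lc ^ m) (legSite (ctr 4 (Lc ^ m)) x b)), colH (coDressKBmAt (ctr 4 (Lc ^ m)) (Lc ^ m) (KInvStep (d := 3) (Lc ^ m) 0)) (Lc ^ m) a 0 α x' * ((((Lc ^ m : ℕ) : ℝ) ^ 4 / 2) * faceWt (ctrOff 4 (Lc ^ m)) (Lc ^ m) α x'))))))) hrate (key m μ ν)).2

end Scales

end Summit.QuantumFields.BalabanUV.Beta.D1BFx.ChartDefectRowLamfScales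

end
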